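import Summits.Ventures.CertifiedManyBodySolver.Observables.ClusterCapFieldTransport
import Summits.Ventures.CertifiedManyBodySolver.Upper.DWaveSourceOpenClusterCapTTPrime
import HarnessLib

/-!
# Reading ONE certified sourced cluster state at EVERY diagonal hopping `t′`: the open `t–t′` box energy is affine
# in `t′`, so a certificate that prints the state's energy AND its diagonal-hopping expectation `K₂` caps the sourced
# energy at every `t′` — `t′`-transport on the PRODUCER side, exact (the `t′`-twin of `ClusterCapFieldTransport`)

Cell hubbard-obs (rung R0/CQ, nodes lane; row «pinning-field response menu nodes — h-chords», seat hubbard-obs-pin-1 g4).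
A cluster certificate (pilot-1 capU2/capU3 4×3, anomaly-1 capTP 4×3, var-10 W5 boxes) evaluates ONE integer vector `ψ` of the open
pair-sourced `a × b` box EXACTLY. The `t–t′` sourced cluster
`A^{tt′}_C(t′; μ, h) = dWaveSourceOpenBoxTT' a b t′ U μ h = dWaveSourceOpenBox a b U μ h + hamiltonian (rectBoxDiagGraph a b) t′ 0`
(pin-1 g2, p470410) is AFFINE in `t′` with slope the unit diagonal-hopping operator of the open box
`T₂ := hamiltonian (rectBoxDiagGraph a b) 1 0 = −Σ_{⟨⟨xy⟩⟩ ⊂ box, σ} c†_{xσ}c_{yσ}` (ordered pairs, i.e. both a term and its conjugate;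
`(a−1)(b−1)·2` diagonal bonds): `A^{tt′}_C(t″) = A^{tt′}_C(t′) + (t″ − t′)·T₂` (`dWaveSourceOpenBoxTT'_tp_affine`), hence
`Re⟨ψ, A^{tt′}_C(t″)ψ⟩ = Re⟨ψ, A^{tt′}_C(t′)ψ⟩ + (t″ − t′)·Re⟨ψ, T₂ψ⟩` (`re_expect_dWaveSourceOpenBoxTT'_tp`). So if the producer prints ONE
more exact rational per vector — the DIAGONAL-HOP ROW `k₂ := Re⟨ψ, T₂ψ⟩/(ab)` (the «K₂ of the trial state» of hubbard-box-p3's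
`DWaveSourceCapClassTPrimeTransport` §9, 2026-08-27T02:04:35Z; for the tiled product state only intra-box diagonal bonds contribute, pin-1
`expect_prodFamily_hamiltonian_fermionTorusDiagGraph`) — the same vector is an energy CAP at every `t″`: moving DOWN in `t′` (`t″ ≤ t′`,
coefficient `t″ − t′ ≤ 0`) consumes a LOWER diag-hop row `k2lo·(ab) ≤ Re⟨ψ, T₂ψ⟩` and gives cap `u + (t″ − t′)·k2lo`
(`clusterCapTT'_tp_down`); moving UP consumes the UPPER row and gives `u + (t″ − t′)·k2hi` (`clusterCapTT'_tp_up`). §3 packages this for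
CLAIM NODES: (i) the DIAG-HOP NODE = the standard five-conjunct `t–t′` node plus two trailing rows `k2lo·(ab) ≤ Re⟨ψ,T₂ψ⟩ ≤ k2hi·(ab)`
⇒ the STANDARD five-conjunct `t–t′` node at `t″` (`clusterNodeTT'_at_tp_{down,up}_of_diagHopNode`) — consumable verbatim by
`sourcedEnergyUpperRow_of_exists_clusterStateTT'` (pin-1 p470410), hubbard-cq-p6's `exists_canonicalClass_sourced_le_of_clusterCapInterval_of_clusterCapTT'`,
p2's TT′ bridge, obsth-2's interval readers; (ii) the TWO-FIELD DIAG-HOP NODE = obsth-2's seven-conjunct two-field `t–t′` node plus the two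
diag-hop rows (NINE conjuncts) ⇒ obsth-2's seven-conjunct TWO-FIELD `t–t′` node at `t″`
(`twoFieldNodeTT'_at_tp_{down,up}_of_twoFieldDiagHopNode`; the zero-field rows move by the same `(t″ − t′)·k₂` because `T₂` does not
depend on `h`) ⇒ then `clusterNodeTT'_at_field_{down,up}_of_twoFieldNode` reads it at every field: ONE certified vector with rows
(E(h), E(0), N, K₂) is a sourced energy cap on the whole `(t′, h)` plane of its `(U, μ)`. §4 composes (i) with the torus row:
`sourcedEnergyUpperRow_at_tp_{down,up}_of_diagHopNode` (`SourcedEnergyUpperRow t″ U μ h q L₀ e` for any rational `e` above the transported cap).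
Slot convention for producers (EXACT rationals per site): `k2 = Re⟨v|hamiltonian (rectBoxDiagGraph a b) 1 0|v⟩/⟨v|v⟩/(ab)` — MINUS the
diagonal hopping expectation summed over ordered diagonal pairs inside the box and both spins; a `t′ = 0` vector (capU2/capU3) has a
generally NONZERO `k2` (it is an observable of the vector, not a term of its Hamiltonian).

HONEST FRAMING: exact bookkeeping on ONE trial state (a variational CEILING moved along its own affine line in `t′`); the leaves it
feeds are CONDITIONAL finite-field RESPONSE floors / cap rows at other `t′` (claim nodes as hypotheses, CANDIDATE until readers + referee),
never order parameters, no phase word, not a superconductivity verdict. Zero compute; no definition; no named fact; no `sorry`.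
References: D. Ruelle, *Statistical Mechanics: Rigorous Results* (1969) §3.3 (trial states); Xu et al., Science 384 (2024) eadh7691
eq. (1) (the `t–t′` sourced model); Koma–Tasaki, J. Stat. Phys. 76 (1994) 745 §1.
-/

noncomputable section

namespace Summit.Ventures.CertifiedManyBodySolver.Observables

open Matrix Literature.Probability.LatticeModels
open Literature.MathematicalPhysics.QuantumLattice Literature.MathematicalPhysics.QuantumLattice.ThermodynamicLimit
open Literature.MathematicalPhysics.QuantumLattice.TwoCluster
open scoped ComplexOrder

/-! ### §1 The `t–t′` open box is affine in the diagonal hopping -/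

section AffineTP

variable (a b : ℕ) (U μ h : ℝ)

/-- A pure hopping Hamiltonian is linear in its amplitude: `hamiltonian G s 0 = s • hamiltonian G 1 0`. [folklore] -/
theorem hamiltonian_rectBoxDiagGraph_zero_eq_smul (s : ℝ) :
    hamiltonian (rectBoxDiagGraph a b) s 0 = (s : ℂ) • hamiltonian (rectBoxDiagGraph a b) 1 0 := by
  simp only [hamiltonian, Complex.ofReal_zero, zero_smul, add_zero, Complex.ofReal_one, smul_smul, mul_neg_one]

/-- **`A^{tt′}_C(t″) = A^{tt′}_C(t′) + (t″ − t′)·T₂`** with `T₂ = hamiltonian (rectBoxDiagGraph a b) 1 0` the unit diagonal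
hopping of the open box: the `t–t′` sourced cluster is affine in `t′`. [cite: XuEtAl2024, eq. (1)] -/
theorem dWaveSourceOpenBoxTT'_tp_affine (tp tp' : ℝ) :
    dWaveSourceOpenBoxTT' a b tp' U μ h =
      dWaveSourceOpenBoxTT' a b tp U μ h + ((tp' - tp : ℝ) : ℂ) • hamiltonian (rectBoxDiagGraph a b) 1 0 := by
  unfold dWaveSourceOpenBoxTT'
  rw [hamiltonian_rectBoxDiagGraph_zero_eq_smul a b tp', hamiltonian_rectBoxDiagGraph_zero_eq_smul a b tp,
    Complex.ofReal_sub, sub_smul]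
  abel

/-- Real parts along the `t′` affine line: `Re⟨ψ, A^{tt′}_C(t″)ψ⟩ = Re⟨ψ, A^{tt′}_C(t′)ψ⟩ + (t″ − t′)·Re⟨ψ, T₂ψ⟩`.
[cite: XuEtAl2024, eq. (1)] -/
theorem re_expect_dWaveSourceOpenBoxTT'_tp (tp tp' : ℝ) (ψ : Fock (Orb (Fin a ×ₗ Fin b))) :
    (star ψ ⬝ᵥ (dWaveSourceOpenBoxTT' a b tp' U μ h *ᵥ ψ)).re =
      (star ψ ⬝ᵥ (dWaveSourceOpenBoxTT' a b tp U μ h *ᵥ ψ)).re +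
        (tp' - tp) * (star ψ ⬝ᵥ (hamiltonian (rectBoxDiagGraph a b) 1 0 *ᵥ ψ)).re := by
  rw [dWaveSourceOpenBoxTT'_tp_affine a b U μ h tp tp']
  simp only [Matrix.add_mulVec, dotProduct_add, Matrix.smul_mulVec, dotProduct_smul, smul_eq_mul, Complex.add_re,
    Complex.re_ofReal_mul]

/-- From the `t′ = 0` cluster: `Re⟨ψ, A^{tt′}_C(t′)ψ⟩ = Re⟨ψ, A_C ψ⟩ + t′·Re⟨ψ, T₂ψ⟩` (`A_C = dWaveSourceOpenBox a b U μ h`).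
[cite: XuEtAl2024, eq. (1)] -/
theorem re_expect_dWaveSourceOpenBoxTT'_eq_re_expect_add_tp_mul (tp : ℝ) (ψ : Fock (Orb (Fin a ×ₗ Fin b))) :
    (star ψ ⬝ᵥ (dWaveSourceOpenBoxTT' a b tp U μ h *ᵥ ψ)).re =
      (star ψ ⬝ᵥ (dWaveSourceOpenBox a b U μ h *ᵥ ψ)).re +
        tp * (star ψ ⬝ᵥ (hamiltonian (rectBoxDiagGraph a b) 1 0 *ᵥ ψ)).re := by
  rw [re_expect_dWaveSourceOpenBoxTT'_tp a b U μ h 0 tp ψ, dWaveSourceOpenBoxTT'_zero_tp, sub_zero]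

end AffineTP

/-! ### §2 Caps moved along `t′` -/

section Caps

variable {a b : ℕ} {tp tp' U μ h u k2lo k2hi : ℝ} {ψ : Fock (Orb (Fin a ×ₗ Fin b))}

/-- **Reading DOWN in `t′`** (`t″ ≤ t′`): the cap `Re⟨ψ, A^{tt′}_C(t′)ψ⟩ ≤ u·(ab)` and the LOWER diag-hop row
`k2lo·(ab) ≤ Re⟨ψ, T₂ψ⟩` give `Re⟨ψ, A^{tt′}_C(t″)ψ⟩ ≤ (u + (t″ − t′)·k2lo)·(ab)`. [cite: Ruelle1969, §3.3] -/
theorem clusterCapTT'_tp_down (htp : tp' ≤ tp)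
    (hE : (star ψ ⬝ᵥ (dWaveSourceOpenBoxTT' a b tp U μ h *ᵥ ψ)).re ≤ u * ((a : ℝ) * b))
    (hK : k2lo * ((a : ℝ) * b) ≤ (star ψ ⬝ᵥ (hamiltonian (rectBoxDiagGraph a b) 1 0 *ᵥ ψ)).re) :
    (star ψ ⬝ᵥ (dWaveSourceOpenBoxTT' a b tp' U μ h *ᵥ ψ)).re ≤ (u + (tp' - tp) * k2lo) * ((a : ℝ) * b) := by
  rw [re_expect_dWaveSourceOpenBoxTT'_tp a b U μ h tp tp' ψ]
  have h1 : 0 ≤ tp - tp' := sub_nonneg.2 htp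
  nlinarith [mul_le_mul_of_nonneg_left hK h1]

/-- **Reading UP in `t′`** (`t′ ≤ t″`): the cap at `t′` and the UPPER diag-hop row `Re⟨ψ, T₂ψ⟩ ≤ k2hi·(ab)` give
`Re⟨ψ, A^{tt′}_C(t″)ψ⟩ ≤ (u + (t″ − t′)·k2hi)·(ab)`. [cite: Ruelle1969, §3.3] -/
theorem clusterCapTT'_tp_up (htp : tp ≤ tp')
    (hE : (star ψ ⬝ᵥ (dWaveSourceOpenBoxTT' a b tp U μ h *ᵥ ψ)).re ≤ u * ((a : ℝ) * b))
    (hK : (star ψ ⬝ᵥ (hamiltonian (rectBoxDiagGraph a b) 1 0 *ᵥ ψ)).re ≤ k2hi * ((a : ℝ) * b)) :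
    (star ψ ⬝ᵥ (dWaveSourceOpenBoxTT' a b tp' U μ h *ᵥ ψ)).re ≤ (u + (tp' - tp) * k2hi) * ((a : ℝ) * b) := by
  rw [re_expect_dWaveSourceOpenBoxTT'_tp a b U μ h tp tp' ψ]
  have h1 : 0 ≤ tp' - tp := sub_nonneg.2 htp
  nlinarith [mul_le_mul_of_nonneg_left hK h1]

/-- **Floors move too** (needed for the zero-field LOWER row of a two-field node), DOWN in `t′` (`t″ ≤ t′`):
`e·(ab) ≤ Re⟨ψ, A^{tt′}_C(t′)ψ⟩` and `Re⟨ψ, T₂ψ⟩ ≤ k2hi·(ab)` give `(e + (t″ − t′)·k2hi)·(ab) ≤ Re⟨ψ, A^{tt′}_C(t″)ψ⟩`.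
[cite: Ruelle1969, §3.3] -/
theorem clusterFloorTT'_tp_down (htp : tp' ≤ tp)
    (hE : u * ((a : ℝ) * b) ≤ (star ψ ⬝ᵥ (dWaveSourceOpenBoxTT' a b tp U μ h *ᵥ ψ)).re)
    (hK : (star ψ ⬝ᵥ (hamiltonian (rectBoxDiagGraph a b) 1 0 *ᵥ ψ)).re ≤ k2hi * ((a : ℝ) * b)) :
    (u + (tp' - tp) * k2hi) * ((a : ℝ) * b) ≤ (star ψ ⬝ᵥ (dWaveSourceOpenBoxTT' a b tp' U μ h *ᵥ ψ)).re := by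
  rw [re_expect_dWaveSourceOpenBoxTT'_tp a b U μ h tp tp' ψ]
  have h1 : 0 ≤ tp - tp' := sub_nonneg.2 htp
  nlinarith [mul_le_mul_of_nonneg_left hK h1]

/-- Floors UP in `t′` (`t′ ≤ t″`): `e·(ab) ≤ Re⟨ψ, A^{tt′}_C(t′)ψ⟩` and `k2lo·(ab) ≤ Re⟨ψ, T₂ψ⟩` give
`(e + (t″ − t′)·k2lo)·(ab) ≤ Re⟨ψ, A^{tt′}_C(t″)ψ⟩`. [cite: Ruelle1969, §3.3] -/
theorem clusterFloorTT'_tp_up (htp : tp ≤ tp')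
    (hE : u * ((a : ℝ) * b) ≤ (star ψ ⬝ᵥ (dWaveSourceOpenBoxTT' a b tp U μ h *ᵥ ψ)).re)
    (hK : k2lo * ((a : ℝ) * b) ≤ (star ψ ⬝ᵥ (hamiltonian (rectBoxDiagGraph a b) 1 0 *ᵥ ψ)).re) :
    (u + (tp' - tp) * k2lo) * ((a : ℝ) * b) ≤ (star ψ ⬝ᵥ (dWaveSourceOpenBoxTT' a b tp' U μ h *ᵥ ψ)).re := by
  rw [re_expect_dWaveSourceOpenBoxTT'_tp a b U μ h tp tp' ψ]
  have h1 : 0 ≤ tp' - tp := sub_nonneg.2 htp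
  nlinarith [mul_le_mul_of_nonneg_left hK h1]

end Caps

/-! ### §3 Claim-node shapes: the DIAG-HOP node and the TWO-FIELD DIAG-HOP node read at another `t′` -/

section Nodes

variable {a b : ℕ} (U μ : ℝ) {tp tp' h u nlo nhi e0lo e0hi k2lo k2hi : ℝ}

/-- **Diag-hop node ⇒ standard `t–t′` node at a SMALLER `t′`** (`t″ ≤ t′`): from
`∃ ψ, parity ∧ unit ∧ E_{t′}(h) ≤ u·(ab) ∧ nlo·(ab) ≤ N ∧ N ≤ nhi·(ab) ∧ k2lo·(ab) ≤ K₂ ∧ K₂ ≤ k2hi·(ab)` (the v1 conjunct order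
plus two trailing diag-hop rows, `K₂ = Re⟨ψ, hamiltonian (rectBoxDiagGraph a b) 1 0 ψ⟩`) to the standard five-conjunct `t–t′` node at
`t″` with cap `u + (t″ − t′)·k2lo`. [cite: Ruelle1969, §3.3] -/
theorem clusterNodeTT'_at_tp_down_of_diagHopNode (htp : tp' ≤ tp)
    (hC : ∃ ψ : Fock (Orb (Fin a ×ₗ Fin b)), HasParity 0 ψ ∧ star ψ ⬝ᵥ ψ = 1 ∧
      (star ψ ⬝ᵥ (dWaveSourceOpenBoxTT' a b tp U μ h *ᵥ ψ)).re ≤ u * ((a : ℝ) * b) ∧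
      nlo * ((a : ℝ) * b) ≤ (star ψ ⬝ᵥ (totalNumber *ᵥ ψ)).re ∧
      (star ψ ⬝ᵥ (totalNumber *ᵥ ψ)).re ≤ nhi * ((a : ℝ) * b) ∧
      k2lo * ((a : ℝ) * b) ≤ (star ψ ⬝ᵥ (hamiltonian (rectBoxDiagGraph a b) 1 0 *ᵥ ψ)).re ∧
      (star ψ ⬝ᵥ (hamiltonian (rectBoxDiagGraph a b) 1 0 *ᵥ ψ)).re ≤ k2hi * ((a : ℝ) * b)) :
    ∃ ψ : Fock (Orb (Fin a ×ₗ Fin b)), HasParity 0 ψ ∧ star ψ ⬝ᵥ ψ = 1 ∧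
      (star ψ ⬝ᵥ (dWaveSourceOpenBoxTT' a b tp' U μ h *ᵥ ψ)).re ≤ (u + (tp' - tp) * k2lo) * ((a : ℝ) * b) ∧
      nlo * ((a : ℝ) * b) ≤ (star ψ ⬝ᵥ (totalNumber *ᵥ ψ)).re ∧
      (star ψ ⬝ᵥ (totalNumber *ᵥ ψ)).re ≤ nhi * ((a : ℝ) * b) := by
  obtain ⟨ψ, hp, h1, hE, hNlo, hNhi, hKlo, -⟩ := hC
  exact ⟨ψ, hp, h1, clusterCapTT'_tp_down htp hE hKlo, hNlo, hNhi⟩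

/-- **Diag-hop node ⇒ standard `t–t′` node at a LARGER `t′`** (`t′ ≤ t″`; cap `u + (t″ − t′)·k2hi`).
[cite: Ruelle1969, §3.3] -/
theorem clusterNodeTT'_at_tp_up_of_diagHopNode (htp : tp ≤ tp')
    (hC : ∃ ψ : Fock (Orb (Fin a ×ₗ Fin b)), HasParity 0 ψ ∧ star ψ ⬝ᵥ ψ = 1 ∧
      (star ψ ⬝ᵥ (dWaveSourceOpenBoxTT' a b tp U μ h *ᵥ ψ)).re ≤ u * ((a : ℝ) * b) ∧
      nlo * ((a : ℝ) * b) ≤ (star ψ ⬝ᵥ (totalNumber *ᵥ ψ)).re ∧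
      (star ψ ⬝ᵥ (totalNumber *ᵥ ψ)).re ≤ nhi * ((a : ℝ) * b) ∧
      k2lo * ((a : ℝ) * b) ≤ (star ψ ⬝ᵥ (hamiltonian (rectBoxDiagGraph a b) 1 0 *ᵥ ψ)).re ∧
      (star ψ ⬝ᵥ (hamiltonian (rectBoxDiagGraph a b) 1 0 *ᵥ ψ)).re ≤ k2hi * ((a : ℝ) * b)) :
    ∃ ψ : Fock (Orb (Fin a ×ₗ Fin b)), HasParity 0 ψ ∧ star ψ ⬝ᵥ ψ = 1 ∧
      (star ψ ⬝ᵥ (dWaveSourceOpenBoxTT' a b tp' U μ h *ᵥ ψ)).re ≤ (u + (tp' - tp) * k2hi) * ((a : ℝ) * b) ∧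
      nlo * ((a : ℝ) * b) ≤ (star ψ ⬝ᵥ (totalNumber *ᵥ ψ)).re ∧
      (star ψ ⬝ᵥ (totalNumber *ᵥ ψ)).re ≤ nhi * ((a : ℝ) * b) := by
  obtain ⟨ψ, hp, h1, hE, hNlo, hNhi, -, hKhi⟩ := hC
  exact ⟨ψ, hp, h1, clusterCapTT'_tp_up htp hE hKhi, hNlo, hNhi⟩

/-- **The diag-hop node read AT its own `t′`** (drop the diag-hop rows): the standard `t–t′` node. [cite: Ruelle1969, §3.3] -/
theorem clusterNodeTT'_of_diagHopNode
    (hC : ∃ ψ : Fock (Orb (Fin a ×ₗ Fin b)), HasParity 0 ψ ∧ star ψ ⬝ᵥ ψ = 1 ∧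
      (star ψ ⬝ᵥ (dWaveSourceOpenBoxTT' a b tp U μ h *ᵥ ψ)).re ≤ u * ((a : ℝ) * b) ∧
      nlo * ((a : ℝ) * b) ≤ (star ψ ⬝ᵥ (totalNumber *ᵥ ψ)).re ∧
      (star ψ ⬝ᵥ (totalNumber *ᵥ ψ)).re ≤ nhi * ((a : ℝ) * b) ∧
      k2lo * ((a : ℝ) * b) ≤ (star ψ ⬝ᵥ (hamiltonian (rectBoxDiagGraph a b) 1 0 *ᵥ ψ)).re ∧
      (star ψ ⬝ᵥ (hamiltonian (rectBoxDiagGraph a b) 1 0 *ᵥ ψ)).re ≤ k2hi * ((a : ℝ) * b)) :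
    ∃ ψ : Fock (Orb (Fin a ×ₗ Fin b)), HasParity 0 ψ ∧ star ψ ⬝ᵥ ψ = 1 ∧
      (star ψ ⬝ᵥ (dWaveSourceOpenBoxTT' a b tp U μ h *ᵥ ψ)).re ≤ u * ((a : ℝ) * b) ∧
      nlo * ((a : ℝ) * b) ≤ (star ψ ⬝ᵥ (totalNumber *ᵥ ψ)).re ∧
      (star ψ ⬝ᵥ (totalNumber *ᵥ ψ)).re ≤ nhi * ((a : ℝ) * b) := by
  obtain ⟨ψ, hp, h1, hE, hNlo, hNhi, -, -⟩ := hC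
  exact ⟨ψ, hp, h1, hE, hNlo, hNhi⟩

/-- **A `t′ = 0` diag-hop node is a `t–t′` diag-hop node at `t′ = 0`** (`dWaveSourceOpenBox = dWaveSourceOpenBoxTT' … 0 …`), so the
capU2/capU3 vectors with a printed `k₂` row enter the two transports above with `tp = 0`. [cite: Ruelle1969, §3.3] -/
theorem diagHopNodeTT'_zero_of_diagHopNode
    (hC : ∃ ψ : Fock (Orb (Fin a ×ₗ Fin b)), HasParity 0 ψ ∧ star ψ ⬝ᵥ ψ = 1 ∧
      (star ψ ⬝ᵥ (dWaveSourceOpenBox a b U μ h *ᵥ ψ)).re ≤ u * ((a : ℝ) * b) ∧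
      nlo * ((a : ℝ) * b) ≤ (star ψ ⬝ᵥ (totalNumber *ᵥ ψ)).re ∧
      (star ψ ⬝ᵥ (totalNumber *ᵥ ψ)).re ≤ nhi * ((a : ℝ) * b) ∧
      k2lo * ((a : ℝ) * b) ≤ (star ψ ⬝ᵥ (hamiltonian (rectBoxDiagGraph a b) 1 0 *ᵥ ψ)).re ∧
      (star ψ ⬝ᵥ (hamiltonian (rectBoxDiagGraph a b) 1 0 *ᵥ ψ)).re ≤ k2hi * ((a : ℝ) * b)) :
    ∃ ψ : Fock (Orb (Fin a ×ₗ Fin b)), HasParity 0 ψ ∧ star ψ ⬝ᵥ ψ = 1 ∧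
      (star ψ ⬝ᵥ (dWaveSourceOpenBoxTT' a b 0 U μ h *ᵥ ψ)).re ≤ u * ((a : ℝ) * b) ∧
      nlo * ((a : ℝ) * b) ≤ (star ψ ⬝ᵥ (totalNumber *ᵥ ψ)).re ∧
      (star ψ ⬝ᵥ (totalNumber *ᵥ ψ)).re ≤ nhi * ((a : ℝ) * b) ∧
      k2lo * ((a : ℝ) * b) ≤ (star ψ ⬝ᵥ (hamiltonian (rectBoxDiagGraph a b) 1 0 *ᵥ ψ)).re ∧
      (star ψ ⬝ᵥ (hamiltonian (rectBoxDiagGraph a b) 1 0 *ᵥ ψ)).re ≤ k2hi * ((a : ℝ) * b) := by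
  simpa only [dWaveSourceOpenBoxTT'_zero_tp] using hC

/-- **Two-field diag-hop node ⇒ two-field `t–t′` node at a SMALLER `t′`** (`t″ ≤ t′`): the NINE-conjunct node (obsth-2's seven-conjunct
two-field `t–t′` node plus the two diag-hop rows) gives obsth-2's seven-conjunct two-field node at `t″` with cap `u + (t″ − t′)·k2lo`
and zero-field rows `[e0lo + (t″ − t′)·k2hi, e0hi + (t″ − t′)·k2lo]` — `T₂` does not depend on `h`, so both fields move by the same
`(t″ − t′)·K₂`. Feed the result to `clusterNodeTT'_at_field_{down,up}_of_twoFieldNode` to read it at any field. [cite: Ruelle1969, §3.3] -/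
theorem twoFieldNodeTT'_at_tp_down_of_twoFieldDiagHopNode (htp : tp' ≤ tp)
    (hC : ∃ ψ : Fock (Orb (Fin a ×ₗ Fin b)), HasParity 0 ψ ∧ star ψ ⬝ᵥ ψ = 1 ∧
      (star ψ ⬝ᵥ (dWaveSourceOpenBoxTT' a b tp U μ h *ᵥ ψ)).re ≤ u * ((a : ℝ) * b) ∧
      nlo * ((a : ℝ) * b) ≤ (star ψ ⬝ᵥ (totalNumber *ᵥ ψ)).re ∧
      (star ψ ⬝ᵥ (totalNumber *ᵥ ψ)).re ≤ nhi * ((a : ℝ) * b) ∧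
      e0lo * ((a : ℝ) * b) ≤ (star ψ ⬝ᵥ (dWaveSourceOpenBoxTT' a b tp U μ 0 *ᵥ ψ)).re ∧
      (star ψ ⬝ᵥ (dWaveSourceOpenBoxTT' a b tp U μ 0 *ᵥ ψ)).re ≤ e0hi * ((a : ℝ) * b) ∧
      k2lo * ((a : ℝ) * b) ≤ (star ψ ⬝ᵥ (hamiltonian (rectBoxDiagGraph a b) 1 0 *ᵥ ψ)).re ∧
      (star ψ ⬝ᵥ (hamiltonian (rectBoxDiagGraph a b) 1 0 *ᵥ ψ)).re ≤ k2hi * ((a : ℝ) * b)) :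
    ∃ ψ : Fock (Orb (Fin a ×ₗ Fin b)), HasParity 0 ψ ∧ star ψ ⬝ᵥ ψ = 1 ∧
      (star ψ ⬝ᵥ (dWaveSourceOpenBoxTT' a b tp' U μ h *ᵥ ψ)).re ≤ (u + (tp' - tp) * k2lo) * ((a : ℝ) * b) ∧
      nlo * ((a : ℝ) * b) ≤ (star ψ ⬝ᵥ (totalNumber *ᵥ ψ)).re ∧
      (star ψ ⬝ᵥ (totalNumber *ᵥ ψ)).re ≤ nhi * ((a : ℝ) * b) ∧
      (e0lo + (tp' - tp) * k2hi) * ((a : ℝ) * b) ≤ (star ψ ⬝ᵥ (dWaveSourceOpenBoxTT' a b tp' U μ 0 *ᵥ ψ)).re ∧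
      (star ψ ⬝ᵥ (dWaveSourceOpenBoxTT' a b tp' U μ 0 *ᵥ ψ)).re ≤ (e0hi + (tp' - tp) * k2lo) * ((a : ℝ) * b) := by
  obtain ⟨ψ, hp, h1, hE, hNlo, hNhi, hE0lo, hE0hi, hKlo, hKhi⟩ := hC
  exact ⟨ψ, hp, h1, clusterCapTT'_tp_down htp hE hKlo, hNlo, hNhi, clusterFloorTT'_tp_down htp hE0lo hKhi,
    clusterCapTT'_tp_down htp hE0hi hKlo⟩

/-- **Two-field diag-hop node ⇒ two-field `t–t′` node at a LARGER `t′`** (`t′ ≤ t″`; cap `u + (t″ − t′)·k2hi`, zero-field rows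
`[e0lo + (t″ − t′)·k2lo, e0hi + (t″ − t′)·k2hi]`). [cite: Ruelle1969, §3.3] -/
theorem twoFieldNodeTT'_at_tp_up_of_twoFieldDiagHopNode (htp : tp ≤ tp')
    (hC : ∃ ψ : Fock (Orb (Fin a ×ₗ Fin b)), HasParity 0 ψ ∧ star ψ ⬝ᵥ ψ = 1 ∧
      (star ψ ⬝ᵥ (dWaveSourceOpenBoxTT' a b tp U μ h *ᵥ ψ)).re ≤ u * ((a : ℝ) * b) ∧
      nlo * ((a : ℝ) * b) ≤ (star ψ ⬝ᵥ (totalNumber *ᵥ ψ)).re ∧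
      (star ψ ⬝ᵥ (totalNumber *ᵥ ψ)).re ≤ nhi * ((a : ℝ) * b) ∧
      e0lo * ((a : ℝ) * b) ≤ (star ψ ⬝ᵥ (dWaveSourceOpenBoxTT' a b tp U μ 0 *ᵥ ψ)).re ∧
      (star ψ ⬝ᵥ (dWaveSourceOpenBoxTT' a b tp U μ 0 *ᵥ ψ)).re ≤ e0hi * ((a : ℝ) * b) ∧
      k2lo * ((a : ℝ) * b) ≤ (star ψ ⬝ᵥ (hamiltonian (rectBoxDiagGraph a b) 1 0 *ᵥ ψ)).re ∧
      (star ψ ⬝ᵥ (hamiltonian (rectBoxDiagGraph a b) 1 0 *ᵥ ψ)).re ≤ k2hi * ((a : ℝ) * b)) :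
    ∃ ψ : Fock (Orb (Fin a ×ₗ Fin b)), HasParity 0 ψ ∧ star ψ ⬝ᵥ ψ = 1 ∧
      (star ψ ⬝ᵥ (dWaveSourceOpenBoxTT' a b tp' U μ h *ᵥ ψ)).re ≤ (u + (tp' - tp) * k2hi) * ((a : ℝ) * b) ∧
      nlo * ((a : ℝ) * b) ≤ (star ψ ⬝ᵥ (totalNumber *ᵥ ψ)).re ∧
      (star ψ ⬝ᵥ (totalNumber *ᵥ ψ)).re ≤ nhi * ((a : ℝ) * b) ∧
      (e0lo + (tp' - tp) * k2lo) * ((a : ℝ) * b) ≤ (star ψ ⬝ᵥ (dWaveSourceOpenBoxTT' a b tp' U μ 0 *ᵥ ψ)).re ∧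
      (star ψ ⬝ᵥ (dWaveSourceOpenBoxTT' a b tp' U μ 0 *ᵥ ψ)).re ≤ (e0hi + (tp' - tp) * k2hi) * ((a : ℝ) * b) := by
  obtain ⟨ψ, hp, h1, hE, hNlo, hNhi, hE0lo, hE0hi, hKlo, hKhi⟩ := hC
  exact ⟨ψ, hp, h1, clusterCapTT'_tp_up htp hE hKhi, hNlo, hNhi, clusterFloorTT'_tp_up htp hE0lo hKlo,
    clusterCapTT'_tp_up htp hE0hi hKhi⟩

/-- **The two-field diag-hop node read AT its own `t′`** (drop the diag-hop rows): obsth-2's seven-conjunct two-field `t–t′` node.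
[cite: Ruelle1969, §3.3] -/
theorem twoFieldNodeTT'_of_twoFieldDiagHopNode
    (hC : ∃ ψ : Fock (Orb (Fin a ×ₗ Fin b)), HasParity 0 ψ ∧ star ψ ⬝ᵥ ψ = 1 ∧
      (star ψ ⬝ᵥ (dWaveSourceOpenBoxTT' a b tp U μ h *ᵥ ψ)).re ≤ u * ((a : ℝ) * b) ∧
      nlo * ((a : ℝ) * b) ≤ (star ψ ⬝ᵥ (totalNumber *ᵥ ψ)).re ∧
      (star ψ ⬝ᵥ (totalNumber *ᵥ ψ)).re ≤ nhi * ((a : ℝ) * b) ∧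
      e0lo * ((a : ℝ) * b) ≤ (star ψ ⬝ᵥ (dWaveSourceOpenBoxTT' a b tp U μ 0 *ᵥ ψ)).re ∧
      (star ψ ⬝ᵥ (dWaveSourceOpenBoxTT' a b tp U μ 0 *ᵥ ψ)).re ≤ e0hi * ((a : ℝ) * b) ∧
      k2lo * ((a : ℝ) * b) ≤ (star ψ ⬝ᵥ (hamiltonian (rectBoxDiagGraph a b) 1 0 *ᵥ ψ)).re ∧
      (star ψ ⬝ᵥ (hamiltonian (rectBoxDiagGraph a b) 1 0 *ᵥ ψ)).re ≤ k2hi * ((a : ℝ) * b)) :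
    ∃ ψ : Fock (Orb (Fin a ×ₗ Fin b)), HasParity 0 ψ ∧ star ψ ⬝ᵥ ψ = 1 ∧
      (star ψ ⬝ᵥ (dWaveSourceOpenBoxTT' a b tp U μ h *ᵥ ψ)).re ≤ u * ((a : ℝ) * b) ∧
      nlo * ((a : ℝ) * b) ≤ (star ψ ⬝ᵥ (totalNumber *ᵥ ψ)).re ∧
      (star ψ ⬝ᵥ (totalNumber *ᵥ ψ)).re ≤ nhi * ((a : ℝ) * b) ∧
      e0lo * ((a : ℝ) * b) ≤ (star ψ ⬝ᵥ (dWaveSourceOpenBoxTT' a b tp U μ 0 *ᵥ ψ)).re ∧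
      (star ψ ⬝ᵥ (dWaveSourceOpenBoxTT' a b tp U μ 0 *ᵥ ψ)).re ≤ e0hi * ((a : ℝ) * b) := by
  obtain ⟨ψ, hp, h1, hE, hNlo, hNhi, hE0lo, hE0hi, -, -⟩ := hC
  exact ⟨ψ, hp, h1, hE, hNlo, hNhi, hE0lo, hE0hi⟩

/-- **A `t′ = 0` two-field diag-hop node is a `t–t′` one at `t′ = 0`** (for pin-1's `cert_capU2x2_…`-class vectors once a `k₂` row is
printed). [cite: Ruelle1969, §3.3] -/
theorem twoFieldDiagHopNodeTT'_zero_of_twoFieldDiagHopNode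
    (hC : ∃ ψ : Fock (Orb (Fin a ×ₗ Fin b)), HasParity 0 ψ ∧ star ψ ⬝ᵥ ψ = 1 ∧
      (star ψ ⬝ᵥ (dWaveSourceOpenBox a b U μ h *ᵥ ψ)).re ≤ u * ((a : ℝ) * b) ∧
      nlo * ((a : ℝ) * b) ≤ (star ψ ⬝ᵥ (totalNumber *ᵥ ψ)).re ∧
      (star ψ ⬝ᵥ (totalNumber *ᵥ ψ)).re ≤ nhi * ((a : ℝ) * b) ∧
      e0lo * ((a : ℝ) * b) ≤ (star ψ ⬝ᵥ (dWaveSourceOpenBox a b U μ 0 *ᵥ ψ)).re ∧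
      (star ψ ⬝ᵥ (dWaveSourceOpenBox a b U μ 0 *ᵥ ψ)).re ≤ e0hi * ((a : ℝ) * b) ∧
      k2lo * ((a : ℝ) * b) ≤ (star ψ ⬝ᵥ (hamiltonian (rectBoxDiagGraph a b) 1 0 *ᵥ ψ)).re ∧
      (star ψ ⬝ᵥ (hamiltonian (rectBoxDiagGraph a b) 1 0 *ᵥ ψ)).re ≤ k2hi * ((a : ℝ) * b)) :
    ∃ ψ : Fock (Orb (Fin a ×ₗ Fin b)), HasParity 0 ψ ∧ star ψ ⬝ᵥ ψ = 1 ∧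
      (star ψ ⬝ᵥ (dWaveSourceOpenBoxTT' a b 0 U μ h *ᵥ ψ)).re ≤ u * ((a : ℝ) * b) ∧
      nlo * ((a : ℝ) * b) ≤ (star ψ ⬝ᵥ (totalNumber *ᵥ ψ)).re ∧
      (star ψ ⬝ᵥ (totalNumber *ᵥ ψ)).re ≤ nhi * ((a : ℝ) * b) ∧
      e0lo * ((a : ℝ) * b) ≤ (star ψ ⬝ᵥ (dWaveSourceOpenBoxTT' a b 0 U μ 0 *ᵥ ψ)).re ∧
      (star ψ ⬝ᵥ (dWaveSourceOpenBoxTT' a b 0 U μ 0 *ᵥ ψ)).re ≤ e0hi * ((a : ℝ) * b) ∧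
      k2lo * ((a : ℝ) * b) ≤ (star ψ ⬝ᵥ (hamiltonian (rectBoxDiagGraph a b) 1 0 *ᵥ ψ)).re ∧
      (star ψ ⬝ᵥ (hamiltonian (rectBoxDiagGraph a b) 1 0 *ᵥ ψ)).re ≤ k2hi * ((a : ℝ) * b) := by
  simpa only [dWaveSourceOpenBoxTT'_zero_tp] using hC

end Nodes

/-! ### §4 The torus cap row at the new `t′` in one statement -/

section TorusRows

variable {a b q L₀ : ℕ} (U μ : ℝ) {tp tp' h u nlo nhi k2lo k2hi : ℝ}

/-- **Diag-hop node at `t′` ⇒ uniform sourced energy CEILING row at a SMALLER `t″`** (`a ∣ q`, `b ∣ q`, `a, b < L₀`; any rational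
`e ≥ u + (t″ − t′)·k2lo`): `SourcedEnergyUpperRow t″ U μ h q L₀ e`, by `clusterNodeTT'_at_tp_down_of_diagHopNode` and pin-1's
`sourcedEnergyUpperRow_of_exists_clusterStateTT'`. [cite: Ruelle1969, §3.3] -/
theorem sourcedEnergyUpperRow_at_tp_down_of_diagHopNode (hqa : a ∣ q) (hqb : b ∣ q) (hLa0 : a < L₀) (hLb0 : b < L₀)
    (htp : tp' ≤ tp) {e : ℚ} (he : u + (tp' - tp) * k2lo ≤ ((e : ℚ) : ℝ))
    (hC : ∃ ψ : Fock (Orb (Fin a ×ₗ Fin b)), HasParity 0 ψ ∧ star ψ ⬝ᵥ ψ = 1 ∧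
      (star ψ ⬝ᵥ (dWaveSourceOpenBoxTT' a b tp U μ h *ᵥ ψ)).re ≤ u * ((a : ℝ) * b) ∧
      nlo * ((a : ℝ) * b) ≤ (star ψ ⬝ᵥ (totalNumber *ᵥ ψ)).re ∧
      (star ψ ⬝ᵥ (totalNumber *ᵥ ψ)).re ≤ nhi * ((a : ℝ) * b) ∧
      k2lo * ((a : ℝ) * b) ≤ (star ψ ⬝ᵥ (hamiltonian (rectBoxDiagGraph a b) 1 0 *ᵥ ψ)).re ∧
      (star ψ ⬝ᵥ (hamiltonian (rectBoxDiagGraph a b) 1 0 *ᵥ ψ)).re ≤ k2hi * ((a : ℝ) * b)) :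
    SourcedEnergyUpperRow tp' U μ h q L₀ e := by
  obtain ⟨ψ, hp, h1, hE, -, -⟩ := clusterNodeTT'_at_tp_down_of_diagHopNode U μ htp hC
  have hab : (0 : ℝ) ≤ (a : ℝ) * b := by positivity
  exact sourcedEnergyUpperRow_of_exists_clusterStateTT' hqa hqb hLa0 hLb0 tp' U μ h
    ⟨ψ, hp, h1, hE.trans (mul_le_mul_of_nonneg_right he hab)⟩

/-- **Diag-hop node at `t′` ⇒ uniform sourced energy CEILING row at a LARGER `t″`** (any rational `e ≥ u + (t″ − t′)·k2hi`).
[cite: Ruelle1969, §3.3] -/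
theorem sourcedEnergyUpperRow_at_tp_up_of_diagHopNode (hqa : a ∣ q) (hqb : b ∣ q) (hLa0 : a < L₀) (hLb0 : b < L₀)
    (htp : tp ≤ tp') {e : ℚ} (he : u + (tp' - tp) * k2hi ≤ ((e : ℚ) : ℝ))
    (hC : ∃ ψ : Fock (Orb (Fin a ×ₗ Fin b)), HasParity 0 ψ ∧ star ψ ⬝ᵥ ψ = 1 ∧
      (star ψ ⬝ᵥ (dWaveSourceOpenBoxTT' a b tp U μ h *ᵥ ψ)).re ≤ u * ((a : ℝ) * b) ∧
      nlo * ((a : ℝ) * b) ≤ (star ψ ⬝ᵥ (totalNumber *ᵥ ψ)).re ∧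
      (star ψ ⬝ᵥ (totalNumber *ᵥ ψ)).re ≤ nhi * ((a : ℝ) * b) ∧
      k2lo * ((a : ℝ) * b) ≤ (star ψ ⬝ᵥ (hamiltonian (rectBoxDiagGraph a b) 1 0 *ᵥ ψ)).re ∧
      (star ψ ⬝ᵥ (hamiltonian (rectBoxDiagGraph a b) 1 0 *ᵥ ψ)).re ≤ k2hi * ((a : ℝ) * b)) :
    SourcedEnergyUpperRow tp' U μ h q L₀ e := by
  obtain ⟨ψ, hp, h1, hE, -, -⟩ := clusterNodeTT'_at_tp_up_of_diagHopNode U μ htp hC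
  have hab : (0 : ℝ) ≤ (a : ℝ) * b := by positivity
  exact sourcedEnergyUpperRow_of_exists_clusterStateTT' hqa hqb hLa0 hLb0 tp' U μ h
    ⟨ψ, hp, h1, hE.trans (mul_le_mul_of_nonneg_right he hab)⟩

end TorusRows

end Summit.Ventures.CertifiedManyBodySolver.Observables

end
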